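import Literature.Probability.RandomPlanarGeometry.ConformalRemovabilityWhitneyTree
import Literature.Probability.RandomPlanarGeometry.ConformalRemovabilityAnalytic
import HarnessLib

/-!
# Conformal removability: generic lines (Jones–Smirnov 2000, end of the proof of Prop. 1)

P. W. Jones, S. K. Smirnov, *Removability theorems for Sobolev functions and quasiconformal maps*,
Ark. Mat. 38 (2000) 263–279, p. 272: "Notice that a Whitney cube `Q` participates in the estimate
only if the line `l` intersects its shadow, and the measure of the set of such lines is at most
`s(Q)^{n-1}`. Integrating (11) over all lines `l` parallel to the direction `λ` … applying the
Schwarz inequality, we get … `≤ 2n ‖∇f‖_{L²(U)} {Σ_Q s(Q)²}^{1/2} < ∞`."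

We prove the planar version in the form needed for the pointwise two-point estimate on almost
every horizontal line: with `τ` the tail majorant of the Whitney tree (`WhitneyTree.exists_tau`,
`Σ τ² < ∞`; the shadow of a disc through which a ray passes lies within `6 τ` of its centre) and
costs `c(v)` with `Σ c(v)² < ∞`,

* `ae_tsum_indicator_lt_top`: for a.e. `y`, `Σ_{v : |Im v - y| ≤ 6 τ(v)} c(v) < ∞`
  (Tonelli and Cauchy–Schwarz: `∫ Σ_v c(v) 1[|Im v - y| ≤ 6τ(v)] dy = 12 Σ_v c(v) τ(v)`);
* `tsum_mul_le_sqrt_mul_sqrt`: Cauchy–Schwarz for `ℝ≥0∞`-valued series;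
* `exists_finset_tsum_indicator_compl_le`: a convergent `ℝ≥0∞`-series has finite sets with
  arbitrarily small remainder (the choice of the size `Δ` of the hubs, p. 270);
* `tsum_indicator_setLIntegral_ball_le`: the costs `c(v)² = ∫_{B(v, 11 r(v))} |F'|²` of the small
  discs have `Σ ≤ 32400 ∫_O |F'|²` by bounded overlap (`tsum_setLIntegral_ball_le`), and
  `lintegral_enorm_deriv_sq_eq_volume_image`: `∫_O |F'|² = area F(O)` for `F` injective
  holomorphic on `O`.
-/

noncomputable section

open Set Metric MeasureTheory Filter

open scoped NNReal ENNReal Topology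

namespace Literature.Probability.RandomPlanarGeometry

open Literature.Analysis.FluidPDE (IsWhitneyFamily tsum_setLIntegral_ball_le)

variable {Ω : Set ℂ}

/-! ### Two facts on `ℝ≥0∞`-valued series -/

/-- **Cauchy–Schwarz for `ℝ≥0∞`-valued series**:
`Σ f g ≤ (Σ f²)^{1/2} (Σ g²)^{1/2}`. [folklore] -/
theorem tsum_mul_le_sqrt_mul_sqrt {V : Type*} (f g : V → ℝ≥0∞) :
    ∑' v, f v * g v ≤ (∑' v, f v ^ 2) ^ (1 / 2 : ℝ) * (∑' v, g v ^ 2) ^ (1 / 2 : ℝ) := by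
  classical
  rw [ENNReal.tsum_eq_iSup_sum]
  refine iSup_le fun s => ?_
  calc ∑ v ∈ s, f v * g v
      ≤ (∑ v ∈ s, f v ^ (2 : ℝ)) ^ (1 / (2 : ℝ)) * (∑ v ∈ s, g v ^ (2 : ℝ)) ^ (1 / (2 : ℝ)) :=
        ENNReal.inner_le_Lp_mul_Lq s f g Real.HolderConjugate.two_two
    _ ≤ (∑' v, f v ^ 2) ^ (1 / 2 : ℝ) * (∑' v, g v ^ 2) ^ (1 / 2 : ℝ) := by
        gcongr
        · calc ∑ v ∈ s, f v ^ (2 : ℝ) = ∑ v ∈ s, f v ^ 2 := by simp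
            _ ≤ ∑' v, f v ^ 2 := ENNReal.sum_le_tsum s
        · calc ∑ v ∈ s, g v ^ (2 : ℝ) = ∑ v ∈ s, g v ^ 2 := by simp
            _ ≤ ∑' v, g v ^ 2 := ENNReal.sum_le_tsum s

/-- **Small remainders**: if `Σ f < ∞` in `ℝ≥0∞` then for every `ε > 0` some finite set carries
all but `ε` of the sum. [folklore] -/
theorem exists_finset_tsum_indicator_compl_le {V : Type*} {f : V → ℝ≥0∞} (hf : ∑' v, f v ≠ ∞)
    {ε : ℝ≥0∞} (hε : ε ≠ 0) : ∃ s : Finset V, ∑' v, ((↑s : Set V)ᶜ).indicator f v ≤ ε := by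
  classical
  have hsplit : ∀ s : Finset V, ∑' v, f v = ∑ v ∈ s, f v + ∑' v, ((↑s : Set V)ᶜ).indicator f v := by
    intro s
    calc ∑' v, f v = ∑' v, (((↑s : Set V)).indicator f v + ((↑s : Set V)ᶜ).indicator f v) := by
          simp_rw [Set.indicator_self_add_compl_apply]
      _ = ∑' v, ((↑s : Set V)).indicator f v + ∑' v, ((↑s : Set V)ᶜ).indicator f v :=
          ENNReal.tsum_add
      _ = ∑ v ∈ s, f v + ∑' v, ((↑s : Set V)ᶜ).indicator f v := by
          rw [sum_eq_tsum_indicator f s]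
  by_cases hle : ∑' v, f v ≤ ε
  · refine ⟨∅, ?_⟩
    simpa using hle
  · have hlt : ε < ∑' v, f v := not_le.1 hle
    have hεtop : ε ≠ ∞ := ne_top_of_lt hlt
    have h1 : ∑' v, f v - ε < ∑' v, f v := ENNReal.sub_lt_self hf (ne_bot_of_gt hlt) hε
    rw [ENNReal.tsum_eq_iSup_sum] at h1
    obtain ⟨s, hs⟩ := lt_iSup_iff.1 h1
    rw [← ENNReal.tsum_eq_iSup_sum] at hs
    refine ⟨s, ?_⟩
    have hfin : ∑ v ∈ s, f v ≠ ∞ := ne_top_of_le_ne_top hf (ENNReal.sum_le_tsum s)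
    have h2 : ∑' v, ((↑s : Set V)ᶜ).indicator f v = ∑' v, f v - ∑ v ∈ s, f v := by
      rw [hsplit s, ENNReal.add_sub_cancel_left hfin]
    rw [h2]
    exact tsub_le_iff_left.2 ((ENNReal.sub_lt_iff_lt_right hεtop hlt.le).1 hs).le

/-! ### Generic lines -/

/-- **Generic lines** (Jones–Smirnov 2000, p. 272, planar case): if `Σ_v τ(v)² < ∞` and
`Σ_v c(v)² < ∞`, then for almost every `y ∈ ℝ` the costs of the vertices whose `6τ`-neighbourhood
meets the horizontal line `Im z = y` are summable: `Σ_{v : |m(v) - y| ≤ 6 τ(v)} c(v) < ∞`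
(Tonelli: `∫ Σ_v c(v) 1[|m(v) - y| ≤ 6τ(v)] dy = Σ_v 12 τ(v) c(v) ≤ 12 (Σ c²)^{1/2} (Σ τ²)^{1/2}`).
[cite: JonesSmirnov2000, proof of Prop. 1 (p. 272)] -/
theorem ae_tsum_indicator_lt_top {V : Type*} [Countable V] (m : V → ℝ) {τ : V → ℝ}
    (hτ0 : ∀ v, 0 ≤ τ v) (hτs : Summable fun v => τ v ^ 2) {c : V → ℝ≥0∞}
    (hc : ∑' v, c v ^ 2 ≠ ∞) :
    ∀ᵐ y : ℝ, ∑' v, {v | |m v - y| ≤ 6 * τ v}.indicator c v < ∞ := by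
  classical
  set g : V → ℝ → ℝ≥0∞ := fun v y => (Icc (m v - 6 * τ v) (m v + 6 * τ v)).indicator
    (fun _ => c v) y with hg
  have hgi : ∀ v y, {v | |m v - y| ≤ 6 * τ v}.indicator c v = g v y := by
    intro v y
    simp only [hg, Set.indicator_apply, mem_setOf_eq, mem_Icc, abs_sub_le_iff]
    congr 1
    apply propext
    constructor <;> intro h <;> constructor <;> linarith [h.1, h.2]
  simp_rw [hgi]
  have hgm : ∀ v, Measurable (g v) := fun v => measurable_const.indicator measurableSet_Icc
  have hΦm : Measurable fun y => ∑' v, g v y := Measurable.tsum hgm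
  refine ae_lt_top hΦm (ne_of_lt ?_)
  rw [lintegral_tsum fun v => (hgm v).aemeasurable]
  have hgv : ∀ v, ∫⁻ y, g v y = c v * ENNReal.ofReal (12 * τ v) := by
    intro v
    simp only [hg]
    rw [lintegral_indicator_const measurableSet_Icc, Real.volume_Icc]
    congr 2
    ring
  simp_rw [hgv]
  calc ∑' v, c v * ENNReal.ofReal (12 * τ v)
      ≤ (∑' v, c v ^ 2) ^ (1 / 2 : ℝ) * (∑' v, ENNReal.ofReal (12 * τ v) ^ 2) ^ (1 / 2 : ℝ) :=
        tsum_mul_le_sqrt_mul_sqrt _ _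
    _ < ∞ := by
        refine ENNReal.mul_lt_top (ENNReal.rpow_lt_top_of_nonneg (by norm_num) hc)
          (ENNReal.rpow_lt_top_of_nonneg (by norm_num) ?_)
        have : ∑' v, ENNReal.ofReal (12 * τ v) ^ 2 = ENNReal.ofReal (∑' v, 144 * τ v ^ 2) := by
          rw [ENNReal.ofReal_tsum_of_nonneg (fun v => by positivity) (hτs.mul_left 144)]
          refine tsum_congr fun v => ?_
          rw [← ENNReal.ofReal_pow (by linarith [hτ0 v])]
          congr 1
          ring
        rw [this]
        exact ENNReal.ofReal_ne_top

/-! ### The costs of the small Whitney discs -/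

/-- **Bounded overlap of the dilated Whitney discs, for the cost integrals**: if the discs
`B(v, 11 r(v))` of the vertices with `r(v) < δ₀` lie in a measurable set `O`, then
`Σ_{v : r(v) < δ₀} ∫_{B(v, 11 r(v))} f ≤ (16·11+4)² ∫_O f` (`tsum_setLIntegral_ball_le` with the
`1/100`-Lipschitz radius and `M = 11`). [folklore] -/
theorem tsum_indicator_setLIntegral_ball_le (W : WhitneyTree Ω) (hΩo : IsOpen Ω)
    (hΩc : Ωᶜ.Nonempty) {f : ℂ → ℝ≥0∞} (hf : AEMeasurable f) {O : Set ℂ} (hOm : MeasurableSet O)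
    {δ₀ : ℝ} (hsub : ∀ v : W.S, infDist (v : ℂ) Ωᶜ / 100 < δ₀ →
      ball (v : ℂ) (11 * (infDist (v : ℂ) Ωᶜ / 100)) ⊆ O) :
    ∑' v : W.S, {v : W.S | infDist (v : ℂ) Ωᶜ / 100 < δ₀}.indicator
        (fun v => ∫⁻ w in ball (v : ℂ) (11 * (infDist (v : ℂ) Ωᶜ / 100)), f w) v ≤
      ENNReal.ofReal ((16 * 11 + 4) ^ 2) * ∫⁻ w in O, f w := by
  classical
  have h1 : ∀ v : W.S, {v : W.S | infDist (v : ℂ) Ωᶜ / 100 < δ₀}.indicator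
      (fun v => ∫⁻ w in ball (v : ℂ) (11 * (infDist (v : ℂ) Ωᶜ / 100)), f w) v ≤
      ∫⁻ w in ball (v : ℂ) (11 * (infDist (v : ℂ) Ωᶜ / 100)), O.indicator f w := by
    intro v
    by_cases hv : infDist (v : ℂ) Ωᶜ / 100 < δ₀
    · rw [Set.indicator_of_mem (show v ∈ {v : W.S | infDist (v : ℂ) Ωᶜ / 100 < δ₀} from hv)]
      exact setLIntegral_mono' measurableSet_ball fun w hw =>
        (Set.indicator_of_mem (hsub v hv hw) f).ge
    · rw [Set.indicator_of_notMem (show v ∉ {v : W.S | infDist (v : ℂ) Ωᶜ / 100 < δ₀} from hv)]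
      exact bot_le
  have h2 := tsum_setLIntegral_ball_le (volume : Measure ℂ) (lipschitzWith_infDist_div Ω)
    (M := 11) (by norm_num) (by norm_num) W.isWhitney.countable W.isWhitney.disjoint
    (fun x hx => div_pos (infDist_compl_pos hΩo hΩc (W.isWhitney.subset hx)) (by norm_num))
    (hf.indicator hOm)
  rw [Complex.finrank_real_complex] at h2
  calc ∑' v : W.S, {v : W.S | infDist (v : ℂ) Ωᶜ / 100 < δ₀}.indicator
        (fun v => ∫⁻ w in ball (v : ℂ) (11 * (infDist (v : ℂ) Ωᶜ / 100)), f w) v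
      ≤ ∑' v : W.S, ∫⁻ w in ball (v : ℂ) (11 * (infDist (v : ℂ) Ωᶜ / 100)), O.indicator f w :=
        ENNReal.tsum_le_tsum h1
    _ ≤ ENNReal.ofReal ((16 * 11 + 4) ^ 2) *
        ∫⁻ w in ⋃ x ∈ W.S, ball x (11 * (infDist x Ωᶜ / 100)), O.indicator f w := h2
    _ ≤ ENNReal.ofReal ((16 * 11 + 4) ^ 2) * ∫⁻ w, O.indicator f w := by
        gcongr
        exact Measure.restrict_le_self
    _ = ENNReal.ofReal ((16 * 11 + 4) ^ 2) * ∫⁻ w in O, f w := by rw [lintegral_indicator hOm]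

/-- `∫_O ‖F'‖ₑ² = area F(O)` for `F` injective and holomorphic on the open set `O`
(`volume_image_eq_lintegral_deriv`). [folklore] -/
theorem lintegral_enorm_deriv_sq_eq_volume_image {F : ℂ → ℂ} {O : Set ℂ} (hO : IsOpen O)
    (hFd : DifferentiableOn ℂ F O) (hFi : InjOn F O) :
    ∫⁻ w in O, ‖deriv F w‖ₑ ^ 2 = volume (F '' O) := by
  rw [volume_image_eq_lintegral_deriv hO hFd hFi]
  refine lintegral_congr fun w => ?_
  rw [← ofReal_norm, ← ENNReal.ofReal_pow (norm_nonneg _)]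

end Literature.Probability.RandomPlanarGeometry
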